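import Summits.QuantumFields.YangMills.Theorems.SoloInformedNonFreezing
import HarnessLib
import HarnessLib.Audit.Tags

/-!
# QuantumFields / YangMills — non-freezing from a polynomial floor (solo seat `solo-QuantumFields-informed`)

Second kernel file of the non-freezing rung (`SoloInformedNonFreezing.lean`: node `LatticeNonFreezing`,
criterion `RPVariationalWitness → LatticeNonFreezing`). This file records the SIMPLIFICATION found in
session 6: the one-step ratio estimate `f(1) ≥ (1 − δ) f(0)` and the log-convexity transport of the
variational witness are not needed for `LatticeNonFreezing` as typed. It suffices that, at all large `β` and on
every large torus, SOME plaquette pair at time separation `n ≥ β^{1/k}` (polynomially large in `β`) has a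
truncated correlation of size `≥ c β^{−p}` (polynomially small): a polynomial always beats a fixed exponential
`C e^{−μ n} ≤ C e^{−μ β^{1/k}}` for `β` large. The seat's architecture delivers exactly such a floor: with
`A = ∑ₓ h(x) P_x` a mean-zero finite combination of plaquette translates supported at times
`x₀ ∈ [a ℓ, ℓ]`, `ℓ = β^ε`, and `θ` the time reflection, reflection positivity of the free lattice gauge field
inside a clean box plus deterministic field bounds give `⟨θA · A⟩_β ≥ c g⁴ = c β^{−2}` uniformly in the volume,
while `⟨θA · A⟩ = ∑_{(n,y)} W(n,y) ⟨P₀ ; P_{(n,y)}⟩` is a finite weighted sum over displacements with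
`n ≥ 2aℓ` and `∑ |W| ≤ ‖h‖₁²` polynomial in `β` — so by pigeonhole one pair carries `≥ c β^{−2}/‖h‖₁²`.

Contents (all sorry-free, no facts, no axioms beyond the standard three):
* `exists_nat_pow_mul_exp_neg_lt` — `C n^j e^{−μ n} < c` for all large `n` (`μ, c > 0`);
* `PolynomialFloorWitness` — the node: a pair at separation `β ≤ n^k` with `c ≤ β^p |⟨P₀ ; P_{(n,y)}⟩|`;
* `SmearedFloorWitness` — the form the analysis produces: a finite weighted sum of pair correlations over
  displacements with `β ≤ n^k`, of modulus `> c β^{−p} ∑|W|`;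
* `polynomialFloorWitness_of_smeared` (pigeonhole) and `latticeNonFreezing_of_polynomialFloor`
  (polynomial beats exponential), composed in `latticeNonFreezing_of_smearedFloor`.

Informal companion: the seat's `paper/nonfreezing.md` (v2, session 6).
-/

open MeasureTheory Filter Topology
open Literature.MathematicalPhysics.AQFT Literature.MathematicalPhysics.QuantumLattice
open Literature.MathematicalPhysics.QuantumFieldTheory Literature.Probability.LatticeModels

noncomputable section

namespace Summit.QuantumFields.YangMills.Theorems

/-! ### Polynomial times decaying exponential -/

/-- For `μ > 0`, `c > 0`, any real `C` and any `j`: `C · n^j · e^{−μ n} < c` for all large natural `n`. -/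
theorem exists_nat_pow_mul_exp_neg_lt (C μ c : ℝ) (hμ : 0 < μ) (hc : 0 < c) (j : ℕ) :
    ∃ N₀ : ℕ, ∀ n : ℕ, N₀ ≤ n → C * (n : ℝ) ^ j * Real.exp (-(μ * n)) < c := by
  rcases le_or_gt C 0 with hC | hC
  · refine ⟨0, fun n _ => ?_⟩
    have h0 : 0 ≤ (n : ℝ) ^ j * Real.exp (-(μ * n)) := by positivity
    have h1 : C * ((n : ℝ) ^ j * Real.exp (-(μ * n))) ≤ 0 := mul_nonpos_of_nonpos_of_nonneg hC h0
    have h2 : C * (n : ℝ) ^ j * Real.exp (-(μ * n)) ≤ 0 := by rw [mul_assoc]; exact h1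
    exact lt_of_le_of_lt h2 hc
  · have ht : Tendsto (fun x : ℝ => x ^ (j : ℝ) * Real.exp (-μ * x)) atTop (𝓝 0) :=
      tendsto_rpow_mul_exp_neg_mul_atTop_nhds_zero (j : ℝ) μ hμ
    have ht' : Tendsto (fun n : ℕ => (n : ℝ) ^ (j : ℝ) * Real.exp (-μ * n)) atTop (𝓝 0) :=
      ht.comp tendsto_natCast_atTop_atTop
    have hev : ∀ᶠ n : ℕ in atTop, (n : ℝ) ^ (j : ℝ) * Real.exp (-μ * n) < c / C :=
      ht'.eventually_lt_const (div_pos hc hC)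
    obtain ⟨N₀, hN₀⟩ := hev.exists_forall_of_atTop
    refine ⟨N₀, fun n hn => ?_⟩
    have h := hN₀ n hn
    rw [Real.rpow_natCast] at h
    have h' : C * ((n : ℝ) ^ j * Real.exp (-μ * n)) < C * (c / C) := mul_lt_mul_of_pos_left h hC
    rw [mul_div_cancel₀ _ hC.ne'] at h'
    have hexp : Real.exp (-(μ * (n : ℝ))) = Real.exp (-μ * n) := by congr 1; ring
    rw [hexp, mul_assoc]
    exact h'

/-! ### The polynomial floor and the smeared floor -/

/-- **Polynomial floor at polynomial separation.** Per compact simple `G` and representation `r`: there are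
`k p : ℕ` and `c > 0` such that for all large `β`, on EVERY large torus of side `2S+1`, some plaquette pair —
`P = r.curvature` at the origin and its translate by `n ≤ S` in time, `y` in space — with `β ≤ n^k`
(separation at least `β^{1/k}`) has `β^p · |⟨P₀ ; P_{(n,y)}⟩_{β,S}| ≥ c`. The seat's analysis
(paper/nonfreezing.md v2) is a proof plan for this with `n ≍ β^ε`, `p = 2 + 8ε·(…)`. [conjecture: the seat's
analytic target, simplified form of `RPVariationalWitness`] -/
@[conjecture] def PolynomialFloorWitness : Prop :=
  ∀ (G : Type) [Group G] [TopologicalSpace G] [IsTopologicalGroup G] [CompactSpace G],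
    IsCompactSimpleLieGroup G →
      letI : MeasurableSpace G := borel G
      haveI : BorelSpace G := ⟨rfl⟩
      ∀ (r : LatticeRep G), ∃ (k p : ℕ) (c : ℝ), 0 < c ∧
        ∃ β₁ : ℝ, ∀ β : ℝ, β₁ ≤ β → ∃ S₁ : ℕ, ∀ S : ℕ, S₁ ≤ S →
          ∃ (n : ℕ) (y : Site 4), β ≤ (n : ℝ) ^ k ∧ n ≤ S ∧ y 0 = 0 ∧
            c ≤ β ^ p * |latticeConnectedCorr r.ρ β (2 * S + 1) r.curvature.F
                (fun U => r.curvature.F (configShift (-y) U)) n|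

/-- **Smeared floor.** The form in which the clean-box analysis delivers the floor: for all large `β`, on every
large torus, a finite set `s` of displacements `(n, y)` — all with `β ≤ n^k`, `n ≤ S`, `y` spatial — and real
weights `W` (intended: `W(n,y) = ∑ₓ θh(x) h(x + (n,y))`, the coefficients of `⟨θA · A⟩` as a combination of
pair correlations, `∑|W| ≤ ‖h‖₁²`) such that the weighted sum of the pair correlations exceeds
`c β^{−p} ∑ |W|` in modulus (intended: `⟨θA · A⟩ ≥ c' g⁴` by free-field reflection positivity in a clean box,
and `‖h‖₁²` polynomial in `β`). [conjecture: the seat's analytic target in assembled form] -/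
@[conjecture] def SmearedFloorWitness : Prop :=
  ∀ (G : Type) [Group G] [TopologicalSpace G] [IsTopologicalGroup G] [CompactSpace G],
    IsCompactSimpleLieGroup G →
      letI : MeasurableSpace G := borel G
      haveI : BorelSpace G := ⟨rfl⟩
      ∀ (r : LatticeRep G), ∃ (k p : ℕ) (c : ℝ), 0 < c ∧
        ∃ β₁ : ℝ, ∀ β : ℝ, β₁ ≤ β → ∃ S₁ : ℕ, ∀ S : ℕ, S₁ ≤ S →
          ∃ (s : Finset (ℕ × Site 4)) (W : ℕ × Site 4 → ℝ),
            (∀ d ∈ s, β ≤ (d.1 : ℝ) ^ k ∧ d.1 ≤ S ∧ d.2 0 = 0) ∧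
            c * (β ^ p)⁻¹ * (∑ d ∈ s, |W d|) <
              |∑ d ∈ s, W d * latticeConnectedCorr r.ρ β (2 * S + 1) r.curvature.F
                  (fun U => r.curvature.F (configShift (-d.2) U)) d.1|

/-! ### Pigeonhole: smeared floor ⇒ polynomial floor -/

/-- A finite weighted sum cannot exceed `t · ∑|W|` in modulus unless some summand's factor exceeds `t`. -/
theorem exists_lt_abs_of_lt_abs_sum {ι : Type*} (s : Finset ι) (W X : ι → ℝ) (t : ℝ)
    (h : t * (∑ d ∈ s, |W d|) < |∑ d ∈ s, W d * X d|) : ∃ d ∈ s, t < |X d| := by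
  by_contra hcon
  push Not at hcon
  have hle : |∑ d ∈ s, W d * X d| ≤ t * ∑ d ∈ s, |W d| := by
    calc |∑ d ∈ s, W d * X d| ≤ ∑ d ∈ s, |W d * X d| := Finset.abs_sum_le_sum_abs _ _
      _ = ∑ d ∈ s, |W d| * |X d| := by simp_rw [abs_mul]
      _ ≤ ∑ d ∈ s, |W d| * t :=
          Finset.sum_le_sum fun d hd => mul_le_mul_of_nonneg_left (hcon d hd) (abs_nonneg _)
      _ = t * ∑ d ∈ s, |W d| := by rw [← Finset.sum_mul, mul_comm]
  exact absurd h (not_lt.mpr hle)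

/-- **Pigeonhole.** A smeared floor forces a polynomial floor (same `k, p, c`, for `β ≥ max β₁ 1`). -/
theorem polynomialFloorWitness_of_smeared (hW : SmearedFloorWitness) : PolynomialFloorWitness := by
  intro G _ _ _ _ hG
  letI : MeasurableSpace G := borel G
  haveI : BorelSpace G := ⟨rfl⟩
  intro r
  obtain ⟨k, p, c, hc, β₁, hβ₁⟩ := hW G hG r
  refine ⟨k, p, c, hc, max β₁ 1, fun β hβ => ?_⟩
  have hβ₁' : β₁ ≤ β := le_trans (le_max_left _ _) hβ
  have hβpos : 0 < β := lt_of_lt_of_le one_pos (le_trans (le_max_right _ _) hβ)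
  obtain ⟨S₁, hS₁⟩ := hβ₁ β hβ₁'
  refine ⟨S₁, fun S hS => ?_⟩
  obtain ⟨s, W, hsW, hsum⟩ := hS₁ S hS
  obtain ⟨d, hd, hlt⟩ := exists_lt_abs_of_lt_abs_sum s W
    (fun d => latticeConnectedCorr r.ρ β (2 * S + 1) r.curvature.F
      (fun U => r.curvature.F (configShift (-d.2) U)) d.1) (c * (β ^ p)⁻¹) hsum
  obtain ⟨hsep, hdS, hdy⟩ := hsW d hd
  refine ⟨d.1, d.2, hsep, hdS, hdy, ?_⟩
  have hβp : 0 < β ^ p := pow_pos hβpos p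
  have := (mul_lt_mul_of_pos_left hlt hβp).le
  rwa [← mul_assoc, mul_comm (β ^ p) c, mul_assoc, mul_inv_cancel₀ hβp.ne', mul_one] at this

/-! ### Polynomial floor ⇒ non-freezing -/

/-- **Non-freezing from a polynomial floor.** If at separation `n ≥ β^{1/k}` some pair correlation is
`≥ c β^{−p}` (all large `β`, every large torus), then no `(C, μ > 0)` clusters the plaquette field at all
large `β`: `C e^{−μ n} β^p ≤ C n^{kp} e^{−μ n} < c` once `n ≥ N₀(C, μ, c, kp)`, which `β ≥ N₀^k + 1` forces. -/
theorem latticeNonFreezing_of_polynomialFloor (hW : PolynomialFloorWitness) : LatticeNonFreezing := by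
  intro G _ _ _ _ hG
  letI : MeasurableSpace G := borel G
  haveI : BorelSpace G := ⟨rfl⟩
  intro r C μ hμ
  obtain ⟨k, p, c, hc, β₁, hβ₁⟩ := hW G hG r
  obtain ⟨N₀, hN₀⟩ := exists_nat_pow_mul_exp_neg_lt C μ c hμ hc (k * p)
  refine ⟨max β₁ ((N₀ : ℝ) ^ k + 1), fun β hβ => ?_⟩
  have hβ₁' : β₁ ≤ β := le_trans (le_max_left _ _) hβ
  have hβN : (N₀ : ℝ) ^ k + 1 ≤ β := le_trans (le_max_right _ _) hβ
  have hN0 : (0 : ℝ) ≤ (N₀ : ℝ) ^ k := by positivity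
  have hβpos : 0 < β := by linarith
  obtain ⟨S₁, hS₁⟩ := hβ₁ β hβ₁'
  refine ⟨S₁, fun S hS => ?_⟩
  obtain ⟨n, y, hsep, hnS, hy, hfloor⟩ := hS₁ S hS
  refine ⟨n, y, hnS, hy, ?_⟩
  -- `N₀ ≤ n` from `N₀^k < n^k`
  have hNn : N₀ ≤ n := by
    have h1 : (N₀ : ℝ) ^ k < (n : ℝ) ^ k := by linarith
    have h2 : (N₀ : ℝ) < n := lt_of_pow_lt_pow_left₀ k (Nat.cast_nonneg n) h1
    exact_mod_cast h2.le
  have hmain : C * (n : ℝ) ^ (k * p) * Real.exp (-(μ * n)) < c := hN₀ n hNn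
  have hβp : β ^ p ≤ (n : ℝ) ^ (k * p) := by
    rw [pow_mul]; exact pow_le_pow_left₀ hβpos.le hsep p
  have hβppos : 0 < β ^ p := pow_pos hβpos p
  -- generalise the correlation value
  generalize hX : |latticeConnectedCorr r.ρ β (2 * S + 1) r.curvature.F
      (fun U => r.curvature.F (configShift (-y) U)) n| = X at hfloor ⊢
  by_contra hcon
  push Not at hcon
  -- `c ≤ β^p X ≤ β^p C e^{-μ n}`
  have h1 : c ≤ β ^ p * (C * Real.exp (-(μ * n))) :=
    hfloor.trans (mul_le_mul_of_nonneg_left hcon hβppos.le)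
  rcases le_or_gt 0 C with hC | hC
  · have hCe : 0 ≤ C * Real.exp (-(μ * n)) := mul_nonneg hC (Real.exp_pos _).le
    have h2 : β ^ p * (C * Real.exp (-(μ * n))) ≤ (n : ℝ) ^ (k * p) * (C * Real.exp (-(μ * n))) :=
      mul_le_mul_of_nonneg_right hβp hCe
    have h3 : (n : ℝ) ^ (k * p) * (C * Real.exp (-(μ * n))) = C * (n : ℝ) ^ (k * p) * Real.exp (-(μ * n)) := by
      ring
    linarith
  · have hCe : C * Real.exp (-(μ * n)) < 0 := mul_neg_of_neg_of_pos hC (Real.exp_pos _)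
    have h2 : β ^ p * (C * Real.exp (-(μ * n))) < 0 := mul_neg_of_pos_of_neg hβppos hCe
    linarith

/-- **Composition**: the smeared floor (what the clean-box analysis is to deliver) forces lattice non-freezing. -/
theorem latticeNonFreezing_of_smearedFloor (hW : SmearedFloorWitness) : LatticeNonFreezing :=
  latticeNonFreezing_of_polynomialFloor (polynomialFloorWitness_of_smeared hW)

/-- The simplified criterion as a closed proposition (proved). -/
def NonFreezingFloorCriterion : Prop := SmearedFloorWitness → LatticeNonFreezing

/-- `NonFreezingFloorCriterion` holds. -/
theorem NonFreezingFloorCriterion_holds : NonFreezingFloorCriterion := latticeNonFreezing_of_smearedFloor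

end Summit.QuantumFields.YangMills.Theorems

end
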